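import Literature.Analysis.FluidPDE.PeriodicCylinderFrameInversion
import Literature.Analysis.FluidPDE.PeriodicCylinderNeumannFrameWords
import Literature.Analysis.FluidPDE.PeriodicCylinderWordNorms
import HarnessLib

/-!
# The Neumann problem on the period cell near the wall: constant words of `q` on `{r ≥ 1/2}`

Topic `Literature/Analysis/FluidPDE`. Support file (all results proved, no definitions) for the
discharge of `Literature.Analysis.FluidPDE.Ferrari1993_periodicCylinderPressureEstimate` (A. B.
Ferrari, Comm. Math. Phys. **155** (1993), Lemma 2, pp. 280–281: the standard `H^s` estimate of the
Neumann problem (10)–(12)). Near the wall (`1/2 ≤ r ≤ 1`) every constant-direction word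
`∂_{v₁}⋯∂_{v_n} q` (`1 ≤ n ≤ 4`) is, pointwise, a bounded combination of the frame words
`X_ω q`, `ω ∈ {x_h·∇, ∂_θ, ∂_z}^{≤ n}` (`PeriodicCylinderFrameInversion`); every frame word is a
sorted word `P^a J^j E^e q` (the frame commutes, `frameWord_normalForm`), and these are controlled in
`L²(cell)` by the data of the Neumann problem (`PeriodicCylinderNeumannFrameWords`). The zeroth-order
frame term is removed by working with `q − ⨍q` (Poincaré on the cell). Main result
`exists_annulusL2_constWord_le`: for `L > 0`, `M ≥ 1` there is `C` with
`‖∂_{v₁}⋯∂_{v_n} q‖_{L²(cell ∩ {r ≥ 1/2})} ≤ C (𝒟_N(q, G) + ‖∇q‖_{L²(cell)})` for all smooth periodic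
`q, G` with `x_h·∇q = G` on the wall, all `1 ≤ n ≤ 4` and letters of norm `≤ M`
(`𝒟_N = neumannData`). Also: vector-valued words of `∇q` componentwise, and the splitting of the
`L²(cell)` size into the interior and the annulus. All statements are folklore calculus given the
cited estimates of the tree.

Mathlib/tree search: the inputs are `exists_norm_cylWord_constFields_le_frameSum`,
`exists_cellL2_pje_le_data`, `exists_cellL2_sub_average_le`; `lean search 'annulus|normalForm'`
found nothing on the cylinder.
-/

noncomputable section

open MeasureTheory Set Function Filter Topology TopologicalSpace WithLp Metric
open scoped ContDiff NNReal ENNReal InnerProductSpace RealInnerProductSpace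

namespace Literature.Analysis.FluidPDE

open Literature.Analysis.FunctionSpaces

/-- Local notation for physical space `ℝ³ = EuclideanSpace ℝ (Fin 3)`. -/
local notation "ℝ³" => EuclideanSpace ℝ (Fin 3)

/-- Local notation for the closed unit cylinder `{r ≤ 1}`. -/
local notation "𝕂" => closure (SetLike.coe unitCylinder : Set (EuclideanSpace ℝ (Fin 3)))

/-- Local notation for the radial field `P = x_h`. -/
local notation "Pf" => (fun y : EuclideanSpace ℝ (Fin 3) => horizontalProj y)

/-- Local notation for the axial field `E = e₂`. -/
local notation "Ef" => (fun _ : EuclideanSpace ℝ (Fin 3) => cylBasis 2)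

variable {F : Type*} [NormedAddCommGroup F] [NormedSpace ℝ F]

/-! ### Bridges between the word encodings -/

/-- A one-letter word. [folklore] -/
private theorem cylWord_single (V : ℝ³ → ℝ³) (f : ℝ³ → F) : cylWord [V] f = cylDeriv V f := rfl

/-- The constant fields of a list are the `jcWord` of its `some`s. [folklore] -/
theorem constFields_eq_jcWord (vs : List ℝ³) : constFields vs = jcWord (vs.map some) := by
  induction vs with
  | nil => rfl
  | cons v vs ih => rw [constFields_cons, List.map_cons, jcWord_cons, jcField_some, ih]

/-- Nonempty words of fields do not see additive constants. [folklore] -/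
theorem cylWord_append_singleton_sub_const (Ws : List (ℝ³ → ℝ³)) (V : ℝ³ → ℝ³) (f : ℝ³ → ℝ) (c : ℝ) :
    cylWord (Ws ++ [V]) (fun y => f y - c) = cylWord (Ws ++ [V]) f := by
  rw [cylWord_append, cylWord_append, cylWord_single, cylWord_single, cylDeriv_sub_const]

/-- A nonempty constant word does not see additive constants. [folklore] -/
theorem cylWord_constFields_sub_const : ∀ (vs : List ℝ³), vs ≠ [] → ∀ {f : ℝ³ → ℝ} {c : ℝ},
    cylWord (constFields vs) (fun y => f y - c) = cylWord (constFields vs) f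
  | [], h, _, _ => absurd rfl h
  | [v], _, f, c => by
    rw [constFields_cons, constFields_nil, cylWord_single, cylWord_single, cylDeriv_sub_const]
  | v :: w :: vs, _, f, c => by
    rw [constFields_cons, cylWord_cons, cylWord_cons, cylWord_constFields_sub_const (w :: vs) (List.cons_ne_nil _ _)]

/-- A frame word with at least one letter does not see additive constants. [folklore] -/
theorem cylWord_frameWord_succ_sub_const {m : ℕ} (om : Fin (m + 1) → Option Bool) (f : ℝ³ → ℝ) (c : ℝ) :
    cylWord (frameWord om) (fun y => f y - c) = cylWord (frameWord om) f := by
  have hom : om = Fin.cons (om 0) (Fin.tail om) := (Fin.cons_self_tail om).symm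
  rw [hom, frameWord_cons]
  exact cylWord_append_singleton_sub_const _ _ f c

/-! ### The normal form of a frame word -/

/-- Appending `E` to a sorted word. [folklore] -/
theorem pje_append_E (a j e : ℕ) :
    List.replicate a Pf ++ List.replicate j rotGen ++ List.replicate e Ef ++ [Ef] =
      List.replicate a Pf ++ List.replicate j rotGen ++ List.replicate (e + 1) Ef := by
  rw [List.replicate_succ', List.append_assoc]

/-- Appending `J` to a sorted word: `P^a J^j E^e J = P^a J^{j+1} E^e` on the closed cylinder. [folklore] -/
theorem cylWord_pje_append_J (a j e : ℕ) {g : ℝ³ → F} (hg : ContDiffOn ℝ ∞ g 𝕂) :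
    EqOn (cylWord (List.replicate a Pf ++ List.replicate j rotGen ++ List.replicate e Ef ++ [rotGen]) g)
      (cylWord (List.replicate a Pf ++ List.replicate (j + 1) rotGen ++ List.replicate e Ef) g) 𝕂 := by
  intro x hx
  -- left: `P^a (J^j (E^e (J g)))`; right: `P^a (J^j (J (E^e g)))`
  simp only [List.replicate_succ', List.append_assoc, List.cons_append, List.nil_append,
    cylWord_append, cylWord_cons, cylWord_nil]
  refine cylWord_congr _ (cylWord_congr _ (fun y hy => ?_)) hx
  have h := cylDeriv_tanField_cylWord_pje true 0 0 e hg hy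
  simp only [List.replicate_zero, List.nil_append, List.append_nil, tanField] at h
  exact h.symm

/-- Appending `P` to a sorted word: `P^a J^j E^e P = P^{a+1} J^j E^e` on the closed cylinder. [folklore] -/
theorem cylWord_pje_append_P (a j e : ℕ) {g : ℝ³ → F} (hg : ContDiffOn ℝ ∞ g 𝕂) :
    EqOn (cylWord (List.replicate a Pf ++ List.replicate j rotGen ++ List.replicate e Ef ++ [Pf]) g)
      (cylWord (List.replicate (a + 1) Pf ++ List.replicate j rotGen ++ List.replicate e Ef) g) 𝕂 := by
  -- `P` commutes with `J^j E^e`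
  have hcomm := cylDeriv_cylWord_of_comm (F := F) contDiff_horizontalProj
    (List.replicate 0 Pf ++ List.replicate j rotGen ++ List.replicate e Ef)
    (fun _ hW => contDiff_of_frame (mem_frame_of_mem_pje hW))
    (fun W hW f' hf' x' hx' => by
      rcases mem_frame_of_mem_pje hW with rfl | rfl | rfl
      · rfl
      · have h := cylDeriv_tanField_frame_comm (F := F) true Pf (Or.inl rfl) hf' hx'
        simp only [tanField] at h
        exact h.symm
      · have h := cylDeriv_tanField_frame_comm (F := F) false Pf (Or.inl rfl) hf' hx'
        simp only [tanField] at h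
        exact h.symm) hg
  simp only [List.replicate_zero, List.nil_append, cylWord_append] at hcomm
  intro x hx
  simp only [List.replicate_succ', List.append_assoc, List.cons_append, List.nil_append,
    cylWord_append, cylWord_cons, cylWord_nil]
  refine cylWord_congr _ (fun y hy => ?_) hx
  exact (hcomm hy).symm

/-- **The normal form of a frame word**: every word in the commuting frame `{x_h·∇, ∂_θ, ∂_z}` of
length `m` equals a sorted word `P^a J^j E^e` with `a + j + e = m` on the closed cylinder (on smooth
functions). [folklore] -/
theorem frameWord_normalForm : ∀ (m : ℕ) (om : Fin m → Option Bool), ∃ a j e : ℕ, a + j + e = m ∧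
    ∀ {g : ℝ³ → F}, ContDiffOn ℝ ∞ g 𝕂 →
      EqOn (cylWord (frameWord om) g) (cylWord (List.replicate a Pf ++ List.replicate j rotGen ++ List.replicate e Ef) g) 𝕂
  | 0, om => ⟨0, 0, 0, rfl, fun _ => fun x _ => by simp [frameWord_zero]⟩
  | m + 1, om => by
    obtain ⟨a, j, e, hsum, hIH⟩ := frameWord_normalForm m (Fin.tail om)
    have hom : om = Fin.cons (om 0) (Fin.tail om) := (Fin.cons_self_tail om).symm
    -- the innermost letter `om 0`
    have hstep : ∀ {g : ℝ³ → F}, ContDiffOn ℝ ∞ g 𝕂 → EqOn (cylWord (frameWord om) g)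
        (cylWord (List.replicate a Pf ++ List.replicate j rotGen ++ List.replicate e Ef ++ [frameField (om 0)]) g) 𝕂 := by
      intro g hg x hx
      rw [hom, frameWord_cons, Fin.cons_zero, cylWord_append, cylWord_append, cylWord_single]
      exact hIH (contDiffOn_cylDeriv (contDiff_frameField _) hg) hx
    rcases h0 : om 0 with _ | b
    · refine ⟨a + 1, j, e, by omega, fun {g} hg x hx => ?_⟩
      rw [hstep hg hx, h0, frameField_none]
      exact cylWord_pje_append_P a j e hg hx
    · cases b
      · refine ⟨a, j, e + 1, by omega, fun {g} hg x hx => ?_⟩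
        rw [hstep hg hx, h0, frameField_some]
        simp only [tanField]
        rw [pje_append_E]
      · refine ⟨a, j + 1, e, by omega, fun {g} hg x hx => ?_⟩
        rw [hstep hg hx, h0, frameField_some]
        simp only [tanField]
        exact cylWord_pje_append_J a j e hg hx

/-! ### Vector-valued words of the gradient within -/

/-- **Words of the gradient within are componentwise**:
`X_W (∇q) = Σᵢ X_W (∂ᵢ q) eᵢ` on the closed cylinder, for words of smooth fields. [folklore] -/
theorem cylWord_cylGrad_eq_sum : ∀ (Ws : List (ℝ³ → ℝ³)), (∀ V ∈ Ws, ContDiff ℝ ∞ V) →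
    ∀ {q : ℝ³ → ℝ}, ContDiffOn ℝ ∞ q 𝕂 →
      EqOn (cylWord Ws (cylGrad q)) (fun x => ∑ i : Fin 3, cylWord Ws (cylDeriv (fun _ => cylBasis i) q) x • cylBasis i) 𝕂
  | [], _, _, _ => fun x _ => by simp [cylGrad_apply]
  | V :: Ws, hVs, q, hq => by
    intro x hx
    have hVs' : ∀ W ∈ Ws, ContDiff ℝ ∞ W := fun W hW => hVs W (List.mem_cons_of_mem _ hW)
    have ih := cylWord_cylGrad_eq_sum Ws hVs' hq
    have hsm : ∀ i : Fin 3, ContDiffOn ℝ ∞ (cylWord Ws (cylDeriv (fun _ => cylBasis i) q)) 𝕂 := fun i =>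
      contDiffOn_cylWord hVs' (contDiffOn_cylDeriv contDiff_const hq)
    have hsm' : ∀ i : Fin 3, ContDiffOn ℝ ∞ (fun y => cylWord Ws (cylDeriv (fun _ => cylBasis i) q) y • cylBasis i) 𝕂 :=
      fun i => (hsm i).smul contDiffOn_const
    show cylDeriv V (cylWord Ws (cylGrad q)) x = ∑ i : Fin 3, cylWord (V :: Ws) (cylDeriv (fun _ => cylBasis i) q) x • cylBasis i
    rw [cylDeriv_congr ih hx, cylDeriv_finset_sum _ (fun i _ => hsm' i) hx]
    simp only [cylWord_cons]
    refine Finset.sum_congr rfl fun i _ => ?_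
    rw [cylDeriv_smul (hsm i) contDiffOn_const hx, cylDeriv_const, smul_zero, add_zero]

/-- Hence `cellL2 (X_W ∇q) ≤ Σᵢ cellL2 (X_W ∂ᵢ q)`. [folklore] -/
theorem cellL2_cylWord_cylGrad_le (L : ℝ) (Ws : List (ℝ³ → ℝ³)) (hVs : ∀ V ∈ Ws, ContDiff ℝ ∞ V)
    {q : ℝ³ → ℝ} (hq : ContDiffOn ℝ ∞ q 𝕂) :
    cellL2 L (cylWord Ws (cylGrad q)) ≤ ∑ i : Fin 3, cellL2 L (cylWord Ws (cylDeriv (fun _ => cylBasis i) q)) := by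
  have hsm : ∀ i : Fin 3, ContinuousOn (cylWord Ws (cylDeriv (fun _ => cylBasis i) q)) 𝕂 := fun i =>
    (contDiffOn_cylWord hVs (contDiffOn_cylDeriv contDiff_const hq)).continuousOn
  calc cellL2 L (cylWord Ws (cylGrad q)) ≤ cellL2 L (fun x => ∑ i : Fin 3, ‖cylWord Ws (cylDeriv (fun _ => cylBasis i) q) x‖) := by
        refine cellL2_mono L (continuousOn_finsetSum _ fun i _ => (hsm i).norm) fun x hx => ?_
        have hxK : x ∈ 𝕂 := subset_closure (cylinderCell_le_unitCylinder L hx)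
        rw [cylWord_cylGrad_eq_sum Ws hVs hq hxK, Real.norm_of_nonneg (Finset.sum_nonneg fun i _ => norm_nonneg _)]
        refine (norm_sum_le _ _).trans (Finset.sum_le_sum fun i _ => ?_)
        rw [norm_smul, norm_cylBasis, mul_one]
    _ ≤ ∑ i : Fin 3, cellL2 L (fun x => ‖cylWord Ws (cylDeriv (fun _ => cylBasis i) q) x‖) :=
        cellL2_sum_le L _ fun i _ => (hsm i).norm
    _ = ∑ i : Fin 3, cellL2 L (cylWord Ws (cylDeriv (fun _ => cylBasis i) q)) :=
        Finset.sum_congr rfl fun i _ => cellL2_norm L _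

/-! ### Splitting the size on the cell: interior and annulus -/

section Split

variable {F' : Type*} [NormedAddCommGroup F']

/-- **The `L²(cell)` size splits into the interior `{r < ρ}` and the annulus `{r ≥ ρ}`.** [folklore] -/
theorem cellL2_le_interior_add_annulus (L ρ : ℝ) {f : ℝ³ → F'} (hf : ContinuousOn f 𝕂) :
    cellL2 L f ≤ (eLpNorm f 2 (volume.restrict ((cylinderCell L : Set ℝ³) ∩ {x | cylRadius x < ρ}))).toReal +
      (eLpNorm f 2 (volume.restrict ((cylinderCell L : Set ℝ³) ∩ {x | ρ ≤ cylRadius x}))).toReal := by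
  set S : Set ℝ³ := {x | cylRadius x < ρ} with hS
  have hSm : MeasurableSet S := (isOpen_lt continuous_cylRadius continuous_const).measurableSet
  have hScm : MeasurableSet Sᶜ := hSm.compl
  have hSc : Sᶜ = {x : ℝ³ | ρ ≤ cylRadius x} := by ext x; simp [hS, not_lt]
  set μ := volume.restrict (cylinderCell L : Set ℝ³) with hμ
  have hfm : AEStronglyMeasurable f μ := (memLp_two_cylinderCell_of_continuousOn L hf).1
  have hsplit : f = fun x => S.indicator f x + Sᶜ.indicator f x := by
    funext x; exact (Set.indicator_self_add_compl_apply S f x).symm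
  have h1 : eLpNorm f 2 μ ≤ eLpNorm (S.indicator f) 2 μ + eLpNorm (Sᶜ.indicator f) 2 μ := by
    conv_lhs => rw [hsplit]
    exact eLpNorm_add_le (hfm.indicator hSm) (hfm.indicator hScm) (by norm_num)
  rw [eLpNorm_indicator_eq_eLpNorm_restrict hSm, eLpNorm_indicator_eq_eLpNorm_restrict hScm,
    hμ, Measure.restrict_restrict hSm, Measure.restrict_restrict hScm, inter_comm S, inter_comm Sᶜ, hSc] at h1
  have hfin : eLpNorm f 2 μ ≠ ⊤ := (memLp_two_cylinderCell_of_continuousOn L hf).eLpNorm_ne_top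
  have hfin1 : eLpNorm f 2 (volume.restrict ((cylinderCell L : Set ℝ³) ∩ S)) ≠ ⊤ :=
    ne_top_of_le_ne_top hfin (eLpNorm_mono_measure f (Measure.restrict_mono inter_subset_left le_rfl))
  have hfin2 : eLpNorm f 2 (volume.restrict ((cylinderCell L : Set ℝ³) ∩ {x | ρ ≤ cylRadius x})) ≠ ⊤ :=
    ne_top_of_le_ne_top hfin (eLpNorm_mono_measure f (Measure.restrict_mono inter_subset_left le_rfl))
  rw [cellL2, ← ENNReal.toReal_add hfin1 hfin2]
  exact ENNReal.toReal_mono (ENNReal.add_ne_top.2 ⟨hfin1, hfin2⟩) h1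

/-- **A pointwise bound on the annulus passes to the size on the annulus**, and the latter is at most
the size on the cell. [folklore] -/
theorem annulusL2_le_cellL2_of_le (L ρ : ℝ) {f : ℝ³ → F'} {g : ℝ³ → ℝ} (hg : ContinuousOn g 𝕂)
    (h : ∀ x ∈ (cylinderCell L : Set ℝ³), ρ ≤ cylRadius x → ‖f x‖ ≤ g x) :
    (eLpNorm f 2 (volume.restrict ((cylinderCell L : Set ℝ³) ∩ {x | ρ ≤ cylRadius x}))).toReal ≤ cellL2 L g := by
  have hAm : MeasurableSet ((cylinderCell L : Set ℝ³) ∩ {x | ρ ≤ cylRadius x}) :=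
    (cylinderCell L).isOpen.measurableSet.inter (isClosed_le continuous_const continuous_cylRadius).measurableSet
  have h1 : eLpNorm f 2 (volume.restrict ((cylinderCell L : Set ℝ³) ∩ {x | ρ ≤ cylRadius x})) ≤
      eLpNorm g 2 (volume.restrict ((cylinderCell L : Set ℝ³) ∩ {x | ρ ≤ cylRadius x})) := by
    refine eLpNorm_mono_ae ((ae_restrict_iff' hAm).2 (Eventually.of_forall fun x hx => ?_))
    rw [Real.norm_of_nonneg ((norm_nonneg _).trans (h x hx.1 hx.2))]
    exact h x hx.1 hx.2
  have h2 : eLpNorm g 2 (volume.restrict ((cylinderCell L : Set ℝ³) ∩ {x | ρ ≤ cylRadius x})) ≤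
      eLpNorm g 2 (volume.restrict (cylinderCell L : Set ℝ³)) :=
    eLpNorm_mono_measure g (Measure.restrict_mono inter_subset_left le_rfl)
  exact ENNReal.toReal_mono (memLp_two_cylinderCell_of_continuousOn L hg).eLpNorm_ne_top (h1.trans h2)

end Split

/-! ### Constant words on the annulus by the data -/

/-- **Constant words of `q` on the annulus `{r ≥ 1/2}` by the data of the Neumann problem.** For
`L > 0` and `M ≥ 1` there is `C` such that for all `q`, `G` smooth on the closed cylinder, `L`-periodic,
with `x_h·∇q = G` on the wall, and every word of `1 ≤ n ≤ 4` constant letters of norm `≤ M`,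
`‖∂_{v₁}⋯∂_{v_n} q‖_{L²(cell ∩ {r ≥ 1/2})} ≤ C (neumannData L q G + cellL2 (∇q))`.
Proof: frame inversion pointwise on the annulus applied to `q − ⨍q` (the zeroth-order frame term is
then controlled by Poincaré on the cell), the normal form of frame words, and the frame-word estimate.
[folklore] -/
theorem exists_annulusL2_constWord_le {L : ℝ} (hL : 0 < L) {M : ℝ} (hM1 : 1 ≤ M) :
    ∃ C : ℝ, 0 ≤ C ∧ ∀ (q G : ℝ³ → ℝ), ContDiffOn ℝ ∞ q 𝕂 → ContDiffOn ℝ ∞ G 𝕂 →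
      IsAxiallyPeriodic L q → IsAxiallyPeriodic L G →
      (∀ x ∈ frontier (unitCylinder : Set ℝ³), cylDeriv Pf q x = G x) →
      ∀ vs : List ℝ³, 1 ≤ vs.length → vs.length ≤ 4 → (∀ v ∈ vs, ‖v‖ ≤ M) →
        (eLpNorm (cylWord (constFields vs) q) 2
          (volume.restrict ((cylinderCell L : Set ℝ³) ∩ {x | (1 : ℝ) / 2 ≤ cylRadius x}))).toReal ≤
          C * (neumannData L q G + cellL2 L (cylGrad q)) := by
  have hM0 : 0 ≤ M := zero_le_one.trans hM1
  -- constants: frame inversion for each length, frame-word estimate, Poincaré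
  have hfr := fun n => exists_norm_cylWord_constFields_le_frameSum (F := ℝ) hM1 n
  choose Cf hCf0 hCf using hfr
  obtain ⟨C₄, hC₄0, hC₄⟩ := exists_cellL2_pje_le_data hL
  obtain ⟨CP, hCP0, hCP⟩ := exists_cellL2_sub_average_le hL
  -- the number of frame words of length `≤ 4`
  set Nw : ℝ := ∑ m ∈ Finset.range 5, (Fintype.card (Fin m → Option Bool) : ℝ) with hNw
  have hNw0 : 0 ≤ Nw := Finset.sum_nonneg fun m _ => Nat.cast_nonneg _
  set Cmax : ℝ := ∑ n ∈ Finset.range 5, Cf n with hCmax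
  have hCmax0 : 0 ≤ Cmax := Finset.sum_nonneg fun n _ => hCf0 n
  have hCf_le : ∀ n, n ≤ 4 → Cf n ≤ Cmax := fun n hn =>
    Finset.single_le_sum (f := Cf) (fun n _ => hCf0 n) (Finset.mem_range.2 (by omega))
  refine ⟨Cmax * M ^ 4 * (CP + Nw * C₄), by positivity, ?_⟩
  intro q G hq hG hqp hGp hN vs h1 h4 hl
  set n := vs.length with hn
  have hD0 : 0 ≤ neumannData L q G := neumannData_nonneg
  have hg0 : 0 ≤ cellL2 L (cylGrad q) := cellL2_nonneg L _
  -- `q̃ = q − ⨍ q`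
  set qt : ℝ³ → ℝ := fun y => q y - ⨍ y in (cylinderCell L : Set ℝ³), q y with hqt
  have hqt_s : ContDiffOn ℝ ∞ qt 𝕂 := hq.sub contDiffOn_const
  -- the word of `q` is the word of `q̃`
  have hlen : 0 < vs.length := by rw [← hn]; exact h1
  have hne : vs ≠ [] := List.ne_nil_of_length_pos hlen
  have hword : cylWord (constFields vs) q = cylWord (constFields vs) qt := by
    rw [hqt, cylWord_constFields_sub_const vs hne]
  -- the pointwise bound on the annulus
  set g : ℝ³ → ℝ := fun x => Cf n * M ^ n * ∑ m ∈ Finset.range (n + 1), ∑ om : Fin m → Option Bool,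
    ‖cylWord (frameWord om) qt x‖ with hgdef
  have hfw_s : ∀ (m : ℕ) (om : Fin m → Option Bool), ContDiffOn ℝ ∞ (cylWord (frameWord om) qt) 𝕂 := fun m om =>
    contDiffOn_cylWord_frameWord om hqt_s
  have hgc : ContinuousOn g 𝕂 :=
    continuousOn_const.mul (continuousOn_finsetSum _ fun m _ => continuousOn_finsetSum _ fun om _ => (hfw_s m om).continuousOn.norm)
  have hpt : ∀ x ∈ (cylinderCell L : Set ℝ³), (1 : ℝ) / 2 ≤ cylRadius x → ‖cylWord (constFields vs) q x‖ ≤ g x := by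
    intro x hx hr
    rw [hword]
    exact hCf n vs hn.symm hl qt hqt_s (subset_closure (cylinderCell_le_unitCylinder L hx)) hr
  refine (annulusL2_le_cellL2_of_le L _ hgc hpt).trans ?_
  -- `cellL2 g` by the frame words of `q̃`
  have hsum : cellL2 L g ≤ Cf n * M ^ n * ∑ m ∈ Finset.range (n + 1), ∑ om : Fin m → Option Bool,
      cellL2 L (cylWord (frameWord om) qt) := by
    have hc0 : 0 ≤ Cf n * M ^ n := mul_nonneg (hCf0 n) (pow_nonneg hM0 n)
    rw [hgdef, cellL2_const_mul L hc0]
    refine mul_le_mul_of_nonneg_left ?_ hc0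
    refine (cellL2_sum_le L _ fun m _ => continuousOn_finsetSum _ fun om _ => (hfw_s m om).continuousOn.norm).trans
      (Finset.sum_le_sum fun m _ => ?_)
    refine (cellL2_sum_le L _ fun om _ => (hfw_s m om).continuousOn.norm).trans (le_of_eq ?_)
    exact Finset.sum_congr rfl fun om _ => cellL2_norm L _
  refine hsum.trans ?_
  -- the zeroth-order term by Poincaré, the others by the frame-word estimate
  have hzero : ∑ om : Fin 0 → Option Bool, cellL2 L (cylWord (frameWord om) qt) ≤ CP * cellL2 L (cylGrad q) := by
    rw [sum_fin_zero_fun, frameWord_zero, cylWord_nil]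
    exact hCP q hq
  have hpos : ∀ m ∈ Finset.range n, ∑ om : Fin (m + 1) → Option Bool, cellL2 L (cylWord (frameWord om) qt) ≤
      (Fintype.card (Fin (m + 1) → Option Bool) : ℝ) * (C₄ * neumannData L q G) := by
    intro m hm
    have hm' : m + 1 ≤ 4 := by have := Finset.mem_range.1 hm; omega
    calc ∑ om : Fin (m + 1) → Option Bool, cellL2 L (cylWord (frameWord om) qt)
        ≤ ∑ _om : Fin (m + 1) → Option Bool, C₄ * neumannData L q G := by
          refine Finset.sum_le_sum fun om _ => ?_
          obtain ⟨a, j, e, hsum', hEq⟩ := frameWord_normalForm (F := ℝ) (m + 1) om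
          rw [cylWord_frameWord_succ_sub_const om q, cellL2_congr_K (hEq hq)]
          exact hC₄ q G hq hG hqp hGp hN a j e (by omega) (by omega)
      _ = (Fintype.card (Fin (m + 1) → Option Bool) : ℝ) * (C₄ * neumannData L q G) := by
          rw [Finset.sum_const, Finset.card_univ, nsmul_eq_mul]
  have hcards : ∑ m ∈ Finset.range n, (Fintype.card (Fin (m + 1) → Option Bool) : ℝ) ≤ Nw := by
    have h1' : ∑ m ∈ Finset.range n, (Fintype.card (Fin (m + 1) → Option Bool) : ℝ) ≤
        ∑ m ∈ Finset.range (n + 1), (Fintype.card (Fin m → Option Bool) : ℝ) := by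
      rw [Finset.sum_range_succ' (fun m => (Fintype.card (Fin m → Option Bool) : ℝ))]
      exact le_add_of_nonneg_right (Nat.cast_nonneg _)
    refine h1'.trans ?_
    rw [hNw]
    exact Finset.sum_le_sum_of_subset_of_nonneg (Finset.range_mono (by omega)) fun m _ _ => Nat.cast_nonneg _
  have hsplit : ∑ m ∈ Finset.range (n + 1), ∑ om : Fin m → Option Bool, cellL2 L (cylWord (frameWord om) qt) ≤
      CP * cellL2 L (cylGrad q) + Nw * (C₄ * neumannData L q G) := by
    rw [Finset.sum_range_succ' (fun m => ∑ om : Fin m → Option Bool, cellL2 L (cylWord (frameWord om) qt))]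
    rw [add_comm]
    refine add_le_add hzero ?_
    calc ∑ m ∈ Finset.range n, ∑ om : Fin (m + 1) → Option Bool, cellL2 L (cylWord (frameWord om) qt)
        ≤ ∑ m ∈ Finset.range n, (Fintype.card (Fin (m + 1) → Option Bool) : ℝ) * (C₄ * neumannData L q G) :=
          Finset.sum_le_sum hpos
      _ = (∑ m ∈ Finset.range n, (Fintype.card (Fin (m + 1) → Option Bool) : ℝ)) * (C₄ * neumannData L q G) := by
          rw [Finset.sum_mul]
      _ ≤ Nw * (C₄ * neumannData L q G) := mul_le_mul_of_nonneg_right hcards (by positivity)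
  have hMn : M ^ n ≤ M ^ 4 := pow_le_pow_right₀ hM1 h4
  have hCfn : Cf n ≤ Cmax := hCf_le n h4
  calc Cf n * M ^ n * ∑ m ∈ Finset.range (n + 1), ∑ om : Fin m → Option Bool, cellL2 L (cylWord (frameWord om) qt)
      ≤ Cf n * M ^ n * (CP * cellL2 L (cylGrad q) + Nw * (C₄ * neumannData L q G)) :=
        mul_le_mul_of_nonneg_left hsplit (mul_nonneg (hCf0 n) (pow_nonneg hM0 n))
    _ ≤ Cmax * M ^ 4 * (CP * cellL2 L (cylGrad q) + Nw * (C₄ * neumannData L q G)) := by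
        refine mul_le_mul_of_nonneg_right (mul_le_mul hCfn hMn (by positivity) hCmax0) (by positivity)
    _ ≤ Cmax * M ^ 4 * (CP + Nw * C₄) * (neumannData L q G + cellL2 L (cylGrad q)) := by
        have h2 : CP * cellL2 L (cylGrad q) + Nw * (C₄ * neumannData L q G) ≤
            (CP + Nw * C₄) * (neumannData L q G + cellL2 L (cylGrad q)) := by
          nlinarith [mul_nonneg hCP0 hD0, mul_nonneg (mul_nonneg hNw0 hC₄0) hg0]
        calc _ ≤ Cmax * M ^ 4 * ((CP + Nw * C₄) * (neumannData L q G + cellL2 L (cylGrad q))) :=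
              mul_le_mul_of_nonneg_left h2 (by positivity)
          _ = _ := by ring

end Literature.Analysis.FluidPDE
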